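import Summits.CriticalPhenomena.PercolationContinuityZ3.Theorems.Transplant.FKConnectivityAllQAntipodalMinorDefs
import Summits.CriticalPhenomena.PercolationContinuityZ3.Theorems.Transplant.FKConnectivityAllQAntipodalGluing
import HarnessLib

/-!
# Connectivity correlation inequalities for `φ_{w,q}`, every `q > 0` — file 22a: series / parallel composition laws of the antipodal
# up-correlation functional WITH A CONTRACTED SET

Support file (`--supports stmt-CriticalPhenomena-4575`), FK sub-lane `prim-bschramm-fk-2` (gen 11) of the post-continuity
programme; builds on p205010 (kernel theorem, internal audit signed; external expert review pending).  No definitions, no named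
facts, no sorries; standard axioms.

`…AntipodalGluing.lean` verbatim with a contracted edge set `C` riding along inside both members of every complementary pair
(`FK.apUpcC q M C s t h = ∑_{γ ⊆ M} q^{k(γ∪C)+k((M\γ)∪C)} (c(γ∪C) − c((M\γ)∪C)) h(γ)`, `…AntipodalMinorDefs.lean`): for a parallel
(resp. series) gluing `E₁ ⊔ E₂` with `M_i, C_i ⊆ E_i`, the glued configurations are `(γ₁ ∪ C₁) ⊔ (γ₂ ∪ C₂)` and their complements-with-`C`,
so `FK.clusterCount_parallel` / `FK.clusterCount_series` and `FK.reachable_parallel_iff` / `FK.reachable_series_iff` apply to them as they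
stand: `FK.apExpC_parallel` / `FK.apExpC_series` (exponent splitting), `FK.apC_summand_parallel` / `FK.apC_summand_series` (the same
sixteen-case pointwise type identities), `FK.apUpcC_parallel_eq` / `FK.apUpcC_series_eq` (composition laws: the parts' functionals on the
SECTIONS of `h` with nonnegative type weights), `FK.apUpcC_parallel_nonneg` / `FK.apUpcC_series_nonneg` (closure of nonnegativity on monotone
test functions, `q > 0`).  The point of the generalization (`…AntipodalMinorUpc.lean`): the antipodal sums with a contracted set are ALL the
coefficients of `Z_H(z)² Cov_{φ_{z,q}}(f, g)` (monomial `z^{2·1_C + 1_M}`), not only the square-free ones.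
[cite: Grimmett2006, §1.4 eq. (1.20) (p. 15); §3.8 Thm. (3.90) (pp. 61–62)] [cite: Wagner2006, Thm. 5.8(d), §5.3]
-/

noncomputable section

namespace Summit.CriticalPhenomena.PercolationContinuityZ3.Theorems

namespace FK

open SimpleGraph Literature.Probability.LatticeModels Literature.Probability.Percolation
open scoped Classical

variable {V : Type*} [Fintype V]

omit [Fintype V] in
/-- Regrouping two glued configurations with their contracted sets. [folklore] -/
theorem union_union_glue (γ₁ γ₂ C₁ C₂ : Finset (Sym2 V)) : γ₁ ∪ γ₂ ∪ (C₁ ∪ C₂) = γ₁ ∪ C₁ ∪ (γ₂ ∪ C₂) :=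
  Finset.union_union_union_comm γ₁ γ₂ C₁ C₂

/-! ### Parallel composition -/

section Parallel

variable {E₁ E₂ : Finset (Sym2 V)} {V₁ V₂ : Set V} {s t : V}

/-- **Parallel gluing, antipodal exponent with contracted sets.** [cite: Grimmett2006, §3.8 (pp. 61–62)] -/
theorem apExpC_parallel (hd : Disjoint E₁ E₂) (h₁ : ∀ e ∈ (↑E₁ : Set (Sym2 V)), ∀ z ∈ e, z ∈ V₁)
    (h₂ : ∀ e ∈ (↑E₂ : Set (Sym2 V)), ∀ z ∈ e, z ∈ V₂) (hS : V₁ ∩ V₂ ⊆ {s, t}) (hst : s ≠ t)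
    {M₁ M₂ C₁ C₂ γ₁ γ₂ : Finset (Sym2 V)} (hM₁ : M₁ ⊆ E₁) (hM₂ : M₂ ⊆ E₂) (hC₁ : C₁ ⊆ E₁) (hC₂ : C₂ ⊆ E₂)
    (hγ₁ : γ₁ ⊆ M₁) (hγ₂ : γ₂ ⊆ M₂) :
    apExpC (M₁ ∪ M₂) (C₁ ∪ C₂) (γ₁ ∪ γ₂) + 2 * Fintype.card V =
      apExpC M₁ C₁ γ₁ + apExpC M₂ C₂ γ₂ +
        ((if (openGraph (↑(γ₁ ∪ C₁) : BondConfig V)).Reachable s t ∧ (openGraph (↑(γ₂ ∪ C₂) : BondConfig V)).Reachable s t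
            then 1 else 0) +
          (if (openGraph (↑(M₁ \ γ₁ ∪ C₁) : BondConfig V)).Reachable s t ∧
              (openGraph (↑(M₂ \ γ₂ ∪ C₂) : BondConfig V)).Reachable s t then 1 else 0)) := by
  have hdM : Disjoint M₁ M₂ := Finset.disjoint_of_subset_left hM₁ (Finset.disjoint_of_subset_right hM₂ hd)
  have k1 := clusterCount_parallel (ω₁ := (↑(γ₁ ∪ C₁) : Set (Sym2 V))) (ω₂ := (↑(γ₂ ∪ C₂) : Set (Sym2 V))) h₁ h₂ hS
    (Finset.coe_subset.2 (Finset.union_subset (hγ₁.trans hM₁) hC₁))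
    (Finset.coe_subset.2 (Finset.union_subset (hγ₂.trans hM₂) hC₂)) hst
  have k2 := clusterCount_parallel (ω₁ := (↑(M₁ \ γ₁ ∪ C₁) : Set (Sym2 V))) (ω₂ := (↑(M₂ \ γ₂ ∪ C₂) : Set (Sym2 V)))
    h₁ h₂ hS (Finset.coe_subset.2 (Finset.union_subset (Finset.sdiff_subset.trans hM₁) hC₁))
    (Finset.coe_subset.2 (Finset.union_subset (Finset.sdiff_subset.trans hM₂) hC₂)) hst
  have e1 : (↑(γ₁ ∪ γ₂ ∪ (C₁ ∪ C₂)) : BondConfig V) = ↑(γ₁ ∪ C₁) ∪ ↑(γ₂ ∪ C₂) := by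
    rw [union_union_glue γ₁ γ₂ C₁ C₂, Finset.coe_union]
  have e2 : (↑((M₁ ∪ M₂) \ (γ₁ ∪ γ₂) ∪ (C₁ ∪ C₂)) : BondConfig V) = ↑(M₁ \ γ₁ ∪ C₁) ∪ ↑(M₂ \ γ₂ ∪ C₂) := by
    rw [union_sdiff_union hdM hγ₁ hγ₂, union_union_glue (M₁ \ γ₁) (M₂ \ γ₂) C₁ C₂, Finset.coe_union]
  unfold apExpC
  rw [e1, e2]
  omega

set_option linter.unusedSimpArgs false in
/-- **Parallel gluing, the antipodal summand with contracted sets** (pointwise identity, sixteen cases).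
[cite: Grimmett2006, §3.8 (pp. 61–62)] -/
theorem apC_summand_parallel (q : ℝ) (hd : Disjoint E₁ E₂) (h₁ : ∀ e ∈ (↑E₁ : Set (Sym2 V)), ∀ z ∈ e, z ∈ V₁)
    (h₂ : ∀ e ∈ (↑E₂ : Set (Sym2 V)), ∀ z ∈ e, z ∈ V₂) (hS : V₁ ∩ V₂ ⊆ {s, t}) (hst : s ≠ t)
    {M₁ M₂ C₁ C₂ γ₁ γ₂ : Finset (Sym2 V)} (hM₁ : M₁ ⊆ E₁) (hM₂ : M₂ ⊆ E₂) (hC₁ : C₁ ⊆ E₁) (hC₂ : C₂ ⊆ E₂)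
    (hγ₁ : γ₁ ⊆ M₁) (hγ₂ : γ₂ ⊆ M₂) (x : ℝ) :
    q ^ (2 * Fintype.card V) *
        (q ^ apExpC (M₁ ∪ M₂) (C₁ ∪ C₂) (γ₁ ∪ γ₂) *
          ((apConn (γ₁ ∪ γ₂ ∪ (C₁ ∪ C₂)) s t - apConn ((M₁ ∪ M₂) \ (γ₁ ∪ γ₂) ∪ (C₁ ∪ C₂)) s t) * x)) =
      q ^ apExpC M₂ C₂ γ₂ *
          (((1 - apConn (γ₂ ∪ C₂) s t) * (1 - apConn (M₂ \ γ₂ ∪ C₂) s t) +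
              q * ((1 - apConn (γ₂ ∪ C₂) s t) * apConn (M₂ \ γ₂ ∪ C₂) s t)) *
            (q ^ apExpC M₁ C₁ γ₁ * ((apConn (γ₁ ∪ C₁) s t - apConn (M₁ \ γ₁ ∪ C₁) s t) * x))) +
        q ^ apExpC M₁ C₁ γ₁ *
          (((1 - apConn (γ₁ ∪ C₁) s t) * (1 - apConn (M₁ \ γ₁ ∪ C₁) s t) +
              q * (apConn (γ₁ ∪ C₁) s t * (1 - apConn (M₁ \ γ₁ ∪ C₁) s t))) *
            (q ^ apExpC M₂ C₂ γ₂ * ((apConn (γ₂ ∪ C₂) s t - apConn (M₂ \ γ₂ ∪ C₂) s t) * x))) := by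
  have hdM : Disjoint M₁ M₂ := Finset.disjoint_of_subset_left hM₁ (Finset.disjoint_of_subset_right hM₂ hd)
  have hexp := apExpC_parallel hd h₁ h₂ hS hst hM₁ hM₂ hC₁ hC₂ hγ₁ hγ₂
  have hpow : q ^ (2 * Fintype.card V) * q ^ apExpC (M₁ ∪ M₂) (C₁ ∪ C₂) (γ₁ ∪ γ₂) =
      q ^ apExpC M₁ C₁ γ₁ * q ^ apExpC M₂ C₂ γ₂ *
        (q ^ (if (openGraph (↑(γ₁ ∪ C₁) : BondConfig V)).Reachable s t ∧
              (openGraph (↑(γ₂ ∪ C₂) : BondConfig V)).Reachable s t then 1 else 0) *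
          q ^ (if (openGraph (↑(M₁ \ γ₁ ∪ C₁) : BondConfig V)).Reachable s t ∧
              (openGraph (↑(M₂ \ γ₂ ∪ C₂) : BondConfig V)).Reachable s t then 1 else 0)) := by
    rw [← pow_add, ← pow_add, ← pow_add, ← pow_add, add_comm (2 * Fintype.card V), hexp]
  have hc : (openGraph (↑(γ₁ ∪ γ₂ ∪ (C₁ ∪ C₂)) : BondConfig V)).Reachable s t ↔
      (openGraph (↑(γ₁ ∪ C₁) : BondConfig V)).Reachable s t ∨ (openGraph (↑(γ₂ ∪ C₂) : BondConfig V)).Reachable s t := by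
    rw [union_union_glue]
    exact reachable_union_parallel h₁ h₂ hS (Finset.union_subset (hγ₁.trans hM₁) hC₁)
      (Finset.union_subset (hγ₂.trans hM₂) hC₂)
  have hcb : (openGraph (↑((M₁ ∪ M₂) \ (γ₁ ∪ γ₂) ∪ (C₁ ∪ C₂)) : BondConfig V)).Reachable s t ↔
      (openGraph (↑(M₁ \ γ₁ ∪ C₁) : BondConfig V)).Reachable s t ∨
        (openGraph (↑(M₂ \ γ₂ ∪ C₂) : BondConfig V)).Reachable s t := by
    rw [union_sdiff_union hdM hγ₁ hγ₂, union_union_glue]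
    exact reachable_union_parallel h₁ h₂ hS (Finset.union_subset (Finset.sdiff_subset.trans hM₁) hC₁)
      (Finset.union_subset (Finset.sdiff_subset.trans hM₂) hC₂)
  calc q ^ (2 * Fintype.card V) *
        (q ^ apExpC (M₁ ∪ M₂) (C₁ ∪ C₂) (γ₁ ∪ γ₂) *
          ((apConn (γ₁ ∪ γ₂ ∪ (C₁ ∪ C₂)) s t - apConn ((M₁ ∪ M₂) \ (γ₁ ∪ γ₂) ∪ (C₁ ∪ C₂)) s t) * x))
      = (q ^ (2 * Fintype.card V) * q ^ apExpC (M₁ ∪ M₂) (C₁ ∪ C₂) (γ₁ ∪ γ₂)) *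
          ((apConn (γ₁ ∪ γ₂ ∪ (C₁ ∪ C₂)) s t - apConn ((M₁ ∪ M₂) \ (γ₁ ∪ γ₂) ∪ (C₁ ∪ C₂)) s t) * x) := by ring
    _ = _ := by
      rw [hpow]
      unfold apConn
      rw [hc, hcb]
      by_cases a₁ : (openGraph (↑(γ₁ ∪ C₁) : BondConfig V)).Reachable s t <;>
      by_cases a₂ : (openGraph (↑(γ₂ ∪ C₂) : BondConfig V)).Reachable s t <;>
      by_cases b₁ : (openGraph (↑(M₁ \ γ₁ ∪ C₁) : BondConfig V)).Reachable s t <;>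
      by_cases b₂ : (openGraph (↑(M₂ \ γ₂ ∪ C₂) : BondConfig V)).Reachable s t <;>
      simp only [a₁, a₂, b₁, b₂, and_self, and_true, true_and, and_false, false_and, or_self, or_true, true_or, or_false,
        false_or, if_true, if_false, not_false_eq_true, not_true_eq_false, pow_one, pow_zero] <;> ring

/-- **Parallel composition law of `apUpcC`.** [cite: Grimmett2006, §3.8 Thm. (3.90) (pp. 61–62)] -/
theorem apUpcC_parallel_eq (q : ℝ) (hd : Disjoint E₁ E₂) (h₁ : ∀ e ∈ (↑E₁ : Set (Sym2 V)), ∀ z ∈ e, z ∈ V₁)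
    (h₂ : ∀ e ∈ (↑E₂ : Set (Sym2 V)), ∀ z ∈ e, z ∈ V₂) (hS : V₁ ∩ V₂ ⊆ {s, t}) (hst : s ≠ t)
    {M₁ M₂ C₁ C₂ : Finset (Sym2 V)} (hM₁ : M₁ ⊆ E₁) (hM₂ : M₂ ⊆ E₂) (hC₁ : C₁ ⊆ E₁) (hC₂ : C₂ ⊆ E₂)
    (h : Finset (Sym2 V) → ℝ) :
    q ^ (2 * Fintype.card V) * apUpcC q (M₁ ∪ M₂) (C₁ ∪ C₂) s t h =
      ∑ γ₂ ∈ M₂.powerset, q ^ apExpC M₂ C₂ γ₂ *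
          (((1 - apConn (γ₂ ∪ C₂) s t) * (1 - apConn (M₂ \ γ₂ ∪ C₂) s t) +
              q * ((1 - apConn (γ₂ ∪ C₂) s t) * apConn (M₂ \ γ₂ ∪ C₂) s t)) *
            apUpcC q M₁ C₁ s t (fun γ₁ => h (γ₁ ∪ γ₂))) +
        ∑ γ₁ ∈ M₁.powerset, q ^ apExpC M₁ C₁ γ₁ *
          (((1 - apConn (γ₁ ∪ C₁) s t) * (1 - apConn (M₁ \ γ₁ ∪ C₁) s t) +
              q * (apConn (γ₁ ∪ C₁) s t * (1 - apConn (M₁ \ γ₁ ∪ C₁) s t))) *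
            apUpcC q M₂ C₂ s t (fun γ₂ => h (γ₁ ∪ γ₂))) := by
  have hdM : Disjoint M₁ M₂ := Finset.disjoint_of_subset_left hM₁ (Finset.disjoint_of_subset_right hM₂ hd)
  unfold apUpcC
  rw [Finset.mul_sum, sum_powerset_union_disj hdM]
  simp_rw [Finset.mul_sum]
  rw [Finset.sum_comm (s := M₂.powerset) (t := M₁.powerset), ← Finset.sum_add_distrib]
  refine Finset.sum_congr rfl fun γ₁ hγ₁ => ?_
  rw [← Finset.sum_add_distrib]
  refine Finset.sum_congr rfl fun γ₂ hγ₂ => ?_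
  rw [Finset.mem_powerset] at hγ₁ hγ₂
  exact apC_summand_parallel q hd h₁ h₂ hS hst hM₁ hM₂ hC₁ hC₂ hγ₁ hγ₂ (h (γ₁ ∪ γ₂))

/-- **Closure of `0 ≤ apUpcC` under parallel composition** (`q > 0`). [cite: Grimmett2006, §3.8 Thm. (3.90) (pp. 61–62)] -/
theorem apUpcC_parallel_nonneg {q : ℝ} (hq : 0 < q) (hd : Disjoint E₁ E₂) (h₁ : ∀ e ∈ (↑E₁ : Set (Sym2 V)), ∀ z ∈ e, z ∈ V₁)
    (h₂ : ∀ e ∈ (↑E₂ : Set (Sym2 V)), ∀ z ∈ e, z ∈ V₂) (hS : V₁ ∩ V₂ ⊆ {s, t}) (hst : s ≠ t)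
    {M₁ M₂ C₁ C₂ : Finset (Sym2 V)} (hM₁ : M₁ ⊆ E₁) (hM₂ : M₂ ⊆ E₂) (hC₁ : C₁ ⊆ E₁) (hC₂ : C₂ ⊆ E₂)
    (ih₁ : ∀ h' : Finset (Sym2 V) → ℝ, (∀ ⦃A B : Finset (Sym2 V)⦄, A ⊆ B → B ⊆ M₁ → h' A ≤ h' B) →
      0 ≤ apUpcC q M₁ C₁ s t h')
    (ih₂ : ∀ h' : Finset (Sym2 V) → ℝ, (∀ ⦃A B : Finset (Sym2 V)⦄, A ⊆ B → B ⊆ M₂ → h' A ≤ h' B) →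
      0 ≤ apUpcC q M₂ C₂ s t h')
    {h : Finset (Sym2 V) → ℝ} (hmono : ∀ ⦃A B : Finset (Sym2 V)⦄, A ⊆ B → B ⊆ M₁ ∪ M₂ → h A ≤ h B) :
    0 ≤ apUpcC q (M₁ ∪ M₂) (C₁ ∪ C₂) s t h := by
  have key := apUpcC_parallel_eq q hd h₁ h₂ hS hst hM₁ hM₂ hC₁ hC₂ h
  have hpos : 0 < q ^ (2 * Fintype.card V) := pow_pos hq _
  refine (mul_nonneg_iff_of_pos_left hpos).1 ?_
  rw [key]
  refine add_nonneg (Finset.sum_nonneg fun γ₂ hγ₂ => ?_) (Finset.sum_nonneg fun γ₁ hγ₁ => ?_)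
  · rw [Finset.mem_powerset] at hγ₂
    have hc1 := apConn_le_one (γ₂ ∪ C₂) s t
    have hd0 := apConn_nonneg (M₂ \ γ₂ ∪ C₂) s t
    have hd1 := apConn_le_one (M₂ \ γ₂ ∪ C₂) s t
    refine mul_nonneg (pow_nonneg hq.le _) (mul_nonneg ?_ (ih₁ _ fun A B hAB hB => ?_))
    · exact add_nonneg (mul_nonneg (sub_nonneg.2 hc1) (sub_nonneg.2 hd1))
        (mul_nonneg hq.le (mul_nonneg (sub_nonneg.2 hc1) hd0))
    · exact hmono (Finset.union_subset_union hAB le_rfl) (Finset.union_subset_union hB hγ₂)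
  · rw [Finset.mem_powerset] at hγ₁
    have hc0 := apConn_nonneg (γ₁ ∪ C₁) s t
    have hc1 := apConn_le_one (γ₁ ∪ C₁) s t
    have hd1 := apConn_le_one (M₁ \ γ₁ ∪ C₁) s t
    refine mul_nonneg (pow_nonneg hq.le _) (mul_nonneg ?_ (ih₂ _ fun A B hAB hB => ?_))
    · exact add_nonneg (mul_nonneg (sub_nonneg.2 hc1) (sub_nonneg.2 hd1))
        (mul_nonneg hq.le (mul_nonneg hc0 (sub_nonneg.2 hd1)))
    · exact hmono (Finset.union_subset_union le_rfl hAB) (Finset.union_subset_union hγ₁ hB)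

end Parallel

/-! ### Series composition -/

section Series

variable {E₁ E₂ : Finset (Sym2 V)} {V₁ V₂ : Set V} {a m b : V}

/-- **Series gluing, antipodal exponent with contracted sets.** [cite: Grimmett2006, §3.8 (pp. 61–62)] -/
theorem apExpC_series (hd : Disjoint E₁ E₂) (h₁ : ∀ e ∈ (↑E₁ : Set (Sym2 V)), ∀ z ∈ e, z ∈ V₁)
    (h₂ : ∀ e ∈ (↑E₂ : Set (Sym2 V)), ∀ z ∈ e, z ∈ V₂) (hS : V₁ ∩ V₂ ⊆ {m})
    {M₁ M₂ C₁ C₂ γ₁ γ₂ : Finset (Sym2 V)} (hM₁ : M₁ ⊆ E₁) (hM₂ : M₂ ⊆ E₂) (hC₁ : C₁ ⊆ E₁) (hC₂ : C₂ ⊆ E₂)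
    (hγ₁ : γ₁ ⊆ M₁) (hγ₂ : γ₂ ⊆ M₂) :
    apExpC (M₁ ∪ M₂) (C₁ ∪ C₂) (γ₁ ∪ γ₂) + 2 * Fintype.card V = apExpC M₁ C₁ γ₁ + apExpC M₂ C₂ γ₂ := by
  have hdM : Disjoint M₁ M₂ := Finset.disjoint_of_subset_left hM₁ (Finset.disjoint_of_subset_right hM₂ hd)
  have k1 := clusterCount_series (ω₁ := (↑(γ₁ ∪ C₁) : Set (Sym2 V))) (ω₂ := (↑(γ₂ ∪ C₂) : Set (Sym2 V))) h₁ h₂ hS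
    (Finset.coe_subset.2 (Finset.union_subset (hγ₁.trans hM₁) hC₁))
    (Finset.coe_subset.2 (Finset.union_subset (hγ₂.trans hM₂) hC₂))
  have k2 := clusterCount_series (ω₁ := (↑(M₁ \ γ₁ ∪ C₁) : Set (Sym2 V))) (ω₂ := (↑(M₂ \ γ₂ ∪ C₂) : Set (Sym2 V)))
    h₁ h₂ hS (Finset.coe_subset.2 (Finset.union_subset (Finset.sdiff_subset.trans hM₁) hC₁))
    (Finset.coe_subset.2 (Finset.union_subset (Finset.sdiff_subset.trans hM₂) hC₂))
  have e1 : (↑(γ₁ ∪ γ₂ ∪ (C₁ ∪ C₂)) : BondConfig V) = ↑(γ₁ ∪ C₁) ∪ ↑(γ₂ ∪ C₂) := by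
    rw [union_union_glue γ₁ γ₂ C₁ C₂, Finset.coe_union]
  have e2 : (↑((M₁ ∪ M₂) \ (γ₁ ∪ γ₂) ∪ (C₁ ∪ C₂)) : BondConfig V) = ↑(M₁ \ γ₁ ∪ C₁) ∪ ↑(M₂ \ γ₂ ∪ C₂) := by
    rw [union_sdiff_union hdM hγ₁ hγ₂, union_union_glue (M₁ \ γ₁) (M₂ \ γ₂) C₁ C₂, Finset.coe_union]
  unfold apExpC
  rw [e1, e2]
  omega

set_option linter.unusedSimpArgs false in
/-- **Series gluing, the antipodal summand with contracted sets** (pointwise identity). [cite: Grimmett2006, §3.8 (pp. 61–62)] -/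
theorem apC_summand_series (q : ℝ) (hd : Disjoint E₁ E₂) (h₁ : ∀ e ∈ (↑E₁ : Set (Sym2 V)), ∀ z ∈ e, z ∈ V₁)
    (h₂ : ∀ e ∈ (↑E₂ : Set (Sym2 V)), ∀ z ∈ e, z ∈ V₂) (hS : V₁ ∩ V₂ ⊆ {m}) (haV₂ : a ∉ V₂) (hbV₁ : b ∉ V₁)
    (ham : a ≠ m) (hbm : b ≠ m) (hab : a ≠ b)
    {M₁ M₂ C₁ C₂ γ₁ γ₂ : Finset (Sym2 V)} (hM₁ : M₁ ⊆ E₁) (hM₂ : M₂ ⊆ E₂) (hC₁ : C₁ ⊆ E₁) (hC₂ : C₂ ⊆ E₂)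
    (hγ₁ : γ₁ ⊆ M₁) (hγ₂ : γ₂ ⊆ M₂) (x : ℝ) :
    q ^ (2 * Fintype.card V) *
        (q ^ apExpC (M₁ ∪ M₂) (C₁ ∪ C₂) (γ₁ ∪ γ₂) *
          ((apConn (γ₁ ∪ γ₂ ∪ (C₁ ∪ C₂)) a b - apConn ((M₁ ∪ M₂) \ (γ₁ ∪ γ₂) ∪ (C₁ ∪ C₂)) a b) * x)) =
      q ^ apExpC M₂ C₂ γ₂ * (apConn (M₂ \ γ₂ ∪ C₂) m b *
          (q ^ apExpC M₁ C₁ γ₁ * ((apConn (γ₁ ∪ C₁) a m - apConn (M₁ \ γ₁ ∪ C₁) a m) * x))) +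
        q ^ apExpC M₁ C₁ γ₁ * (apConn (γ₁ ∪ C₁) a m *
          (q ^ apExpC M₂ C₂ γ₂ * ((apConn (γ₂ ∪ C₂) m b - apConn (M₂ \ γ₂ ∪ C₂) m b) * x))) := by
  have hdM : Disjoint M₁ M₂ := Finset.disjoint_of_subset_left hM₁ (Finset.disjoint_of_subset_right hM₂ hd)
  have hexp := apExpC_series hd h₁ h₂ hS hM₁ hM₂ hC₁ hC₂ hγ₁ hγ₂
  have hpow : q ^ (2 * Fintype.card V) * q ^ apExpC (M₁ ∪ M₂) (C₁ ∪ C₂) (γ₁ ∪ γ₂) =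
      q ^ apExpC M₁ C₁ γ₁ * q ^ apExpC M₂ C₂ γ₂ := by
    rw [← pow_add, ← pow_add, add_comm (2 * Fintype.card V), hexp]
  have hc : (openGraph (↑(γ₁ ∪ γ₂ ∪ (C₁ ∪ C₂)) : BondConfig V)).Reachable a b ↔
      (openGraph (↑(γ₁ ∪ C₁) : BondConfig V)).Reachable a m ∧ (openGraph (↑(γ₂ ∪ C₂) : BondConfig V)).Reachable m b := by
    rw [union_union_glue]
    exact reachable_union_series h₁ h₂ hS haV₂ hbV₁ ham hbm hab (Finset.union_subset (hγ₁.trans hM₁) hC₁)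
      (Finset.union_subset (hγ₂.trans hM₂) hC₂)
  have hcb : (openGraph (↑((M₁ ∪ M₂) \ (γ₁ ∪ γ₂) ∪ (C₁ ∪ C₂)) : BondConfig V)).Reachable a b ↔
      (openGraph (↑(M₁ \ γ₁ ∪ C₁) : BondConfig V)).Reachable a m ∧
        (openGraph (↑(M₂ \ γ₂ ∪ C₂) : BondConfig V)).Reachable m b := by
    rw [union_sdiff_union hdM hγ₁ hγ₂, union_union_glue]
    exact reachable_union_series h₁ h₂ hS haV₂ hbV₁ ham hbm hab
      (Finset.union_subset (Finset.sdiff_subset.trans hM₁) hC₁) (Finset.union_subset (Finset.sdiff_subset.trans hM₂) hC₂)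
  calc q ^ (2 * Fintype.card V) *
        (q ^ apExpC (M₁ ∪ M₂) (C₁ ∪ C₂) (γ₁ ∪ γ₂) *
          ((apConn (γ₁ ∪ γ₂ ∪ (C₁ ∪ C₂)) a b - apConn ((M₁ ∪ M₂) \ (γ₁ ∪ γ₂) ∪ (C₁ ∪ C₂)) a b) * x))
      = (q ^ (2 * Fintype.card V) * q ^ apExpC (M₁ ∪ M₂) (C₁ ∪ C₂) (γ₁ ∪ γ₂)) *
          ((apConn (γ₁ ∪ γ₂ ∪ (C₁ ∪ C₂)) a b - apConn ((M₁ ∪ M₂) \ (γ₁ ∪ γ₂) ∪ (C₁ ∪ C₂)) a b) * x) := by ring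
    _ = _ := by
      rw [hpow]
      unfold apConn
      rw [hc, hcb]
      by_cases a₁ : (openGraph (↑(γ₁ ∪ C₁) : BondConfig V)).Reachable a m <;>
      by_cases a₂ : (openGraph (↑(γ₂ ∪ C₂) : BondConfig V)).Reachable m b <;>
      by_cases b₁ : (openGraph (↑(M₁ \ γ₁ ∪ C₁) : BondConfig V)).Reachable a m <;>
      by_cases b₂ : (openGraph (↑(M₂ \ γ₂ ∪ C₂) : BondConfig V)).Reachable m b <;>
      simp only [a₁, a₂, b₁, b₂, and_self, and_true, true_and, and_false, false_and, if_true, if_false,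
        not_false_eq_true, not_true_eq_false] <;> ring

/-- **Series composition law of `apUpcC`.** [cite: Grimmett2006, §3.8 Thm. (3.90) (pp. 61–62)] -/
theorem apUpcC_series_eq (q : ℝ) (hd : Disjoint E₁ E₂) (h₁ : ∀ e ∈ (↑E₁ : Set (Sym2 V)), ∀ z ∈ e, z ∈ V₁)
    (h₂ : ∀ e ∈ (↑E₂ : Set (Sym2 V)), ∀ z ∈ e, z ∈ V₂) (hS : V₁ ∩ V₂ ⊆ {m}) (haV₂ : a ∉ V₂) (hbV₁ : b ∉ V₁)
    (ham : a ≠ m) (hbm : b ≠ m) (hab : a ≠ b) {M₁ M₂ C₁ C₂ : Finset (Sym2 V)} (hM₁ : M₁ ⊆ E₁) (hM₂ : M₂ ⊆ E₂)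
    (hC₁ : C₁ ⊆ E₁) (hC₂ : C₂ ⊆ E₂) (h : Finset (Sym2 V) → ℝ) :
    q ^ (2 * Fintype.card V) * apUpcC q (M₁ ∪ M₂) (C₁ ∪ C₂) a b h =
      ∑ γ₂ ∈ M₂.powerset, q ^ apExpC M₂ C₂ γ₂ *
          (apConn (M₂ \ γ₂ ∪ C₂) m b * apUpcC q M₁ C₁ a m (fun γ₁ => h (γ₁ ∪ γ₂))) +
        ∑ γ₁ ∈ M₁.powerset, q ^ apExpC M₁ C₁ γ₁ *
          (apConn (γ₁ ∪ C₁) a m * apUpcC q M₂ C₂ m b (fun γ₂ => h (γ₁ ∪ γ₂))) := by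
  have hdM : Disjoint M₁ M₂ := Finset.disjoint_of_subset_left hM₁ (Finset.disjoint_of_subset_right hM₂ hd)
  unfold apUpcC
  rw [Finset.mul_sum, sum_powerset_union_disj hdM]
  simp_rw [Finset.mul_sum]
  rw [Finset.sum_comm (s := M₂.powerset) (t := M₁.powerset), ← Finset.sum_add_distrib]
  refine Finset.sum_congr rfl fun γ₁ hγ₁ => ?_
  rw [← Finset.sum_add_distrib]
  refine Finset.sum_congr rfl fun γ₂ hγ₂ => ?_
  rw [Finset.mem_powerset] at hγ₁ hγ₂
  exact apC_summand_series q hd h₁ h₂ hS haV₂ hbV₁ ham hbm hab hM₁ hM₂ hC₁ hC₂ hγ₁ hγ₂ (h (γ₁ ∪ γ₂))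

/-- **Closure of `0 ≤ apUpcC` under series composition** (`q > 0`). [cite: Grimmett2006, §3.8 Thm. (3.90) (pp. 61–62)] -/
theorem apUpcC_series_nonneg {q : ℝ} (hq : 0 < q) (hd : Disjoint E₁ E₂) (h₁ : ∀ e ∈ (↑E₁ : Set (Sym2 V)), ∀ z ∈ e, z ∈ V₁)
    (h₂ : ∀ e ∈ (↑E₂ : Set (Sym2 V)), ∀ z ∈ e, z ∈ V₂) (hS : V₁ ∩ V₂ ⊆ {m}) (haV₂ : a ∉ V₂) (hbV₁ : b ∉ V₁)
    (ham : a ≠ m) (hbm : b ≠ m) (hab : a ≠ b) {M₁ M₂ C₁ C₂ : Finset (Sym2 V)} (hM₁ : M₁ ⊆ E₁) (hM₂ : M₂ ⊆ E₂)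
    (hC₁ : C₁ ⊆ E₁) (hC₂ : C₂ ⊆ E₂)
    (ih₁ : ∀ h' : Finset (Sym2 V) → ℝ, (∀ ⦃A B : Finset (Sym2 V)⦄, A ⊆ B → B ⊆ M₁ → h' A ≤ h' B) →
      0 ≤ apUpcC q M₁ C₁ a m h')
    (ih₂ : ∀ h' : Finset (Sym2 V) → ℝ, (∀ ⦃A B : Finset (Sym2 V)⦄, A ⊆ B → B ⊆ M₂ → h' A ≤ h' B) →
      0 ≤ apUpcC q M₂ C₂ m b h')
    {h : Finset (Sym2 V) → ℝ} (hmono : ∀ ⦃A B : Finset (Sym2 V)⦄, A ⊆ B → B ⊆ M₁ ∪ M₂ → h A ≤ h B) :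
    0 ≤ apUpcC q (M₁ ∪ M₂) (C₁ ∪ C₂) a b h := by
  have key := apUpcC_series_eq q hd h₁ h₂ hS haV₂ hbV₁ ham hbm hab hM₁ hM₂ hC₁ hC₂ h
  have hpos : 0 < q ^ (2 * Fintype.card V) := pow_pos hq _
  refine (mul_nonneg_iff_of_pos_left hpos).1 ?_
  rw [key]
  refine add_nonneg (Finset.sum_nonneg fun γ₂ hγ₂ => ?_) (Finset.sum_nonneg fun γ₁ hγ₁ => ?_)
  · rw [Finset.mem_powerset] at hγ₂
    refine mul_nonneg (pow_nonneg hq.le _) (mul_nonneg (apConn_nonneg _ _ _) (ih₁ _ fun A B hAB hB => ?_))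
    exact hmono (Finset.union_subset_union hAB le_rfl) (Finset.union_subset_union hB hγ₂)
  · rw [Finset.mem_powerset] at hγ₁
    refine mul_nonneg (pow_nonneg hq.le _) (mul_nonneg (apConn_nonneg _ _ _) (ih₂ _ fun A B hAB hB => ?_))
    exact hmono (Finset.union_subset_union le_rfl hAB) (Finset.union_subset_union hγ₁ hB)

end Series

end FK

end Summit.CriticalPhenomena.PercolationContinuityZ3.Theorems

end
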